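import Summits.ABC.StewartYu.PadicTwoAdicCubeRoot
import Summits.ABC.StewartYu.DescentSetupQ
import HarnessLib

/-!
# Cell abc-stewartyu, W80Two (i): the `2`-ADIC set-up over `ℚ₂` — data, logarithms, the linear
# form, norms of the rational data

`Summits/ABC/StewartYu/PadicTwoSetup.lean` — cell `abc-stewartyu` (HOME
`run/shared/lean/pub/abc-stewartyu/`, seat lit; route `PadicPrimesW80TwoThirds`, crux `W80Two`
stmt-ABC-19486; scoping memos HOME/p1/WP-Y2-scoping.md §§1–3 and HOME/p1/W80Two-numerics-scoping.md).
Plain definitions and theorems; no named fact.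

This is the `p = 2`, `q = 3` twin of p2's `PadicTwistSetup.lean` + `PadicTwistValues.lean`
(odd `p`, Teichmüller twist, half points) and of `PadicCW77Setup.lean` (odd `p`, principal units,
CLOSED ball `‖·‖ ≤ p⁻¹`).  At `p = 2` the exponential converges only on the OPEN ball `‖a‖ < 2⁻¹`
(`a ≡ 0 (mod 4)`), so the generators are taken `≡ 1 (mod 8)` (`3 ≤ ord₂(· − 1)`; the transfer to the
crux squares the odd primes, `q² ≡ 1 (mod 8)`), every logarithm has norm `≤ 8⁻¹`, the auxiliary
functions `z ↦ exp(z · ψ_u)` live on `‖z‖ ≤ 2` (`‖z ψ_u‖ ≤ 4⁻¹ < 2⁻¹`), and the descent is Yu's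
`q = 3` descent: the values at the THIRD points `s/3` (`‖s/3‖₂ ≤ 1`) are monomials in the principal
CUBE roots `cbrtᵢ = exp(3⁻¹ · log₂ allᵢ) ∈ ℚ₂`, `cbrtᵢ³ = allᵢ` (p1's `PadicTwoAdicCubeRoot.lean` on
the any-prime open-ball file `PadicLogOpenBall.lean`).  There is NO twist at `p = 2`
(`ℤ₂ˣ = {±1} × (1 + 4ℤ₂)` and the generators are already principal), so the class values of the
twist chain are all `1` and are omitted; otherwise the names follow `TwistSetup`/`TwistValues` so
that the Functions/Series/KStep layers port by substitution.

* `TwoSetup` — `d` free rationals `αⱼ`, the eliminated rational `θ`, all `≡ 1 (mod 8)`; integer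
  coefficients `bⱼ`, `b_θ ≠ 0` of minimal `2`-adic order; `toQ : SetupQ` (p3's sign-free algebraic
  datum), `frame := toQ.flat`;
* `ω`, `norm_one_sub_ω_le` (`≤ 8⁻¹`), `lgAll/lg/lgθ` (`‖·‖ ≤ 8⁻¹`), `exp_lgAll`, `Λ`, `Λ₀`, `Λ_eq`,
  `norm_Λ_eq_mul`, `Θ`, `Λ_eq_plog`, **`norm_Λ : ‖Λ‖ = ‖Θ − 1‖₂`**;
* `2`-adic norms of the rational data: `norm_β_le`, `norm_γ_le`, `norm_qA_le`, `norm_qE`.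
The exponents `ψ_u`, `expo u` and the values at the integer and third points are in the sequel
`PadicTwoValues.lean`.

## References
* [Yu1990] K. Yu, *Linear forms in p-adic logarithms II*, Compositio Math. 74 (1990), §1.1
  (`exp`/`log` on principal units, the case `p = 2`: `q = 3`, (2.1)), §3 (the `q`-descent).
* [Koblitz1984] N. Koblitz, *p-adic Numbers, p-adic Analysis, and Zeta-Functions*, GTM 58, Ch. IV §1–2.
* [CijsouwWaldschmidt1977] P. L. Cijsouw, M. Waldschmidt, Compositio Math. 34 (1977), §4.
-/

noncomputable section

open NormedSpace Finset IsUltrametricDist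
open Literature.NumberTheory.Transcendental
open Literature.NumberTheory.Transcendental.CW77.Setup (Idx Tau tauNorm)
open scoped Nat

namespace Summit.ABC.StewartYu

/-- **The data of the `2`-adic set-up**: `d` free rationals `αⱼ`, the eliminated rational `θ`, all
`≡ 1 (mod 8)` (`3 ≤ ord₂(· − 1)`), integer coefficients `bⱼ` and `b_θ ≠ 0` of minimal `2`-adic order
(so that `βⱼ = −bⱼ/b_θ ∈ ℤ₂`). [cite: Yu1990, §1.1 and Theorem 1 (p = 2)] -/
structure TwoSetup where
  /-- the number of free generators -/
  d : ℕ
  /-- the free generators -/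
  α : Fin d → ℚ
  /-- the eliminated generator -/
  θ : ℚ
  /-- the coefficients of the free logarithms -/
  b : Fin d → ℤ
  /-- the coefficient of `log₂ θ` -/
  bθ : ℤ
  /-- it is non-zero -/
  bθ_ne : bθ ≠ 0
  /-- it has MINIMAL `2`-adic order among the non-zero coefficients -/
  hbmin : ∀ j, b j ≠ 0 → padicValInt 2 bθ ≤ padicValInt 2 (b j)
  /-- the free generators are `≡ 1 (mod 8)` -/
  hα : ∀ j, 3 ≤ padicValRat 2 (α j - 1)
  /-- the eliminated generator is `≡ 1 (mod 8)` -/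
  hθ : 3 ≤ padicValRat 2 (θ - 1)

namespace TwoSetup

variable (S : TwoSetup)

/-! ### Elementary numerics at `p = 2` -/

/-- `8⁻¹ < 2⁻¹` (the level-`3` ball lies in the open ball of the logarithm). [folklore] -/
theorem eighth_lt_half : (8 : ℝ)⁻¹ < ((2 : ℕ) : ℝ)⁻¹ := by norm_num

/-- `8⁻¹ < 1`. [folklore] -/
theorem eighth_lt_one : (8 : ℝ)⁻¹ < 1 := by norm_num

/-- `0 ≤ 8⁻¹`. [folklore] -/
theorem eighth_nonneg : (0 : ℝ) ≤ (8 : ℝ)⁻¹ := by norm_num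

/-- A rational `≡ 1 (mod 8)` is non-zero (`ord₂(0 − 1) = 0 < 3`). [folklore] -/
theorem ne_zero_of_three_le {x : ℚ} (h : 3 ≤ padicValRat 2 (x - 1)) : x ≠ 0 := by
  rintro rfl
  rw [zero_sub, padicValRat.neg, padicValRat.one] at h
  exact absurd h (by norm_num)

/-- A rational `≡ 1 (mod 8)` is `≠ 1` (the valuation of `0` is `0`). [folklore] -/
theorem ne_one_of_three_le {x : ℚ} (h : 3 ≤ padicValRat 2 (x - 1)) : x ≠ 1 :=
  TwoAdic.ne_one_of_padicValRat_pos (by norm_num) h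

/-- `αⱼ ≠ 0`. [folklore] -/
theorem α_ne (j : Fin S.d) : S.α j ≠ 0 := ne_zero_of_three_le (S.hα j)

/-- `θ ≠ 0`. [folklore] -/
theorem θ_ne : S.θ ≠ 0 := ne_zero_of_three_le S.hθ

/-! ### All generators, the sign-free algebraic datum `toQ`, the frame -/

/-- **The sign-free algebraic datum** (p3's `SetupQ`: same `d, α, θ, b, b_θ`), through which every
rational object of the descent (`all`, `qE`, `qTerm`, `coreSum`, …) is imported. [folklore] -/
abbrev toQ : SetupQ := ⟨S.d, S.α, S.θ, S.α_ne, S.θ_ne, S.b, S.bθ, S.bθ_ne⟩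

/-- **The frame**: the positive `CW77.Setup` `S.toQ.flat` carrying all generator-free bookkeeping
(`Idx`, `Tau`, `β`, `γ`, `qΔ`, `qA`, `expn`, boxes). [cite: CijsouwWaldschmidt1977, §4 (p. 184)] -/
abbrev frame : CW77.Setup := S.toQ.flat

/-- All `d + 1` generators are `≡ 1 (mod 8)`. [cite: Yu1990, §1.1] -/
theorem three_le_padicValRat_all (i : Fin (S.d + 1)) : 3 ≤ padicValRat 2 (S.toQ.all i - 1) := by
  unfold SetupQ.all
  refine Fin.lastCases ?_ (fun j => ?_) i
  · rw [Fin.snoc_last]; exact S.hθ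
  · rw [Fin.snoc_castSucc]; exact S.hα j

/-- The generator `allᵢ` read in `ℚ₂` (named `ω` as in the twist chain; at `p = 2` there is no
twist: `ωᵢ = allᵢ`). [cite: Yu1990, §1.1] -/
def ω (i : Fin (S.d + 1)) : ℚ_[2] := (S.toQ.all i : ℚ_[2])

/-- `ωᵢ = allᵢ` in `ℚ₂`. [folklore] -/
theorem ω_def (i : Fin (S.d + 1)) : S.ω i = (S.toQ.all i : ℚ_[2]) := rfl

/-- **The generators are principal units of level `3`**: `‖1 − ωᵢ‖₂ ≤ 8⁻¹`. [cite: Yu1990, §1.1] -/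
theorem norm_one_sub_ω_le (i : Fin (S.d + 1)) : ‖1 - S.ω i‖ ≤ (8 : ℝ)⁻¹ :=
  TwoAdic.norm_one_sub_le_eighth (S.three_le_padicValRat_all i)

/-- `‖1 − ωᵢ‖₂ < 2⁻¹`: the hypothesis of the open-ball API at `ℓ = 2`. [cite: Koblitz1984, Ch. IV §1] -/
theorem norm_one_sub_ω_lt (i : Fin (S.d + 1)) : ‖1 - S.ω i‖ < ((2 : ℕ) : ℝ)⁻¹ :=
  TwoAdic.norm_one_sub_lt_half_of_three_le (S.three_le_padicValRat_all i)

/-- `‖1 − ωᵢ‖₂ < 1`. [folklore] -/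
theorem norm_one_sub_ω_lt_one (i : Fin (S.d + 1)) : ‖1 - S.ω i‖ < 1 :=
  (S.norm_one_sub_ω_le i).trans_lt eighth_lt_one

/-- **The generators are `2`-adic units**: `‖allᵢ‖₂ = 1` (`ωᵢ = allᵢ` read in `ℚ₂`).
[cite: Yu1990, Theorem 2.1 (2.16)] -/
theorem norm_all (i : Fin (S.d + 1)) : ‖(S.toQ.all i : ℚ_[2])‖ = 1 :=
  IwasawaLog.norm_eq_one_of_norm_one_sub_lt (S.norm_one_sub_ω_lt_one i)

/-- `ωᵢ = allᵢ ≠ 0` in `ℚ₂`. [folklore] -/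
theorem ω_ne (i : Fin (S.d + 1)) : (S.toQ.all i : ℚ_[2]) ≠ 0 :=
  norm_pos_iff.mp (by rw [S.norm_all]; exact one_pos)

/-! ### The logarithms -/

/-- `log₂ ωᵢ` (the logarithmic series of the principal unit `ωᵢ`). [cite: Yu1990, §1.1] -/
def lgAll (i : Fin (S.d + 1)) : ℚ_[2] := PadicExp.plog (S.ω i)

/-- `lg j = log₂ αⱼ` (`j < d`). [cite: Yu1990, §1.1] -/
def lg (j : Fin S.d) : ℚ_[2] := S.lgAll (Fin.castSucc j)

/-- `lgθ = log₂ θ`. [cite: Yu1990, §1.1] -/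
def lgθ : ℚ_[2] := S.lgAll (Fin.last S.d)

/-- **`‖log₂ ωᵢ‖ = ‖1 − ωᵢ‖`** (the logarithm is an isometry on the open ball). [cite: Koblitz1984, Ch. IV §1] -/
theorem norm_lgAll_eq (i : Fin (S.d + 1)) : ‖S.lgAll i‖ = ‖1 - S.ω i‖ :=
  PadicExp.norm_plog_of_norm_lt (ℓ := 2) (S.norm_one_sub_ω_lt i)

/-- **`‖log₂ ωᵢ‖ ≤ 8⁻¹`.** [cite: Yu1990, §1.1] -/
theorem norm_lgAll_le (i : Fin (S.d + 1)) : ‖S.lgAll i‖ ≤ (8 : ℝ)⁻¹ := by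
  rw [S.norm_lgAll_eq]; exact S.norm_one_sub_ω_le i

/-- `‖log₂ ωᵢ‖ < 2⁻¹`. [cite: Koblitz1984, Ch. IV §1] -/
theorem norm_lgAll_lt (i : Fin (S.d + 1)) : ‖S.lgAll i‖ < ((2 : ℕ) : ℝ)⁻¹ := by
  rw [S.norm_lgAll_eq]; exact S.norm_one_sub_ω_lt i

/-- `‖lg j‖ ≤ 8⁻¹`. [cite: Yu1990, §1.1] -/
theorem norm_lg_le (j : Fin S.d) : ‖S.lg j‖ ≤ (8 : ℝ)⁻¹ := S.norm_lgAll_le _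

/-- `‖lgθ‖ ≤ 8⁻¹`. [cite: Yu1990, §1.1] -/
theorem norm_lgθ_le : ‖S.lgθ‖ ≤ (8 : ℝ)⁻¹ := S.norm_lgAll_le _

/-- **`exp (log₂ ωᵢ) = ωᵢ = allᵢ`.** [cite: Koblitz1984, Ch. IV §2] -/
theorem exp_lgAll (i : Fin (S.d + 1)) : exp (S.lgAll i) = (S.toQ.all i : ℚ_[2]) :=
  PadicExp.exp_plog_of_norm_lt (ℓ := 2) (S.norm_one_sub_ω_lt i)

/-- `exp (s · log₂ ωᵢ) = allᵢˢ`. [cite: Koblitz1984, Ch. IV §2] -/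
theorem exp_natCast_mul_lgAll (i : Fin (S.d + 1)) (s : ℕ) :
    exp ((s : ℚ_[2]) * S.lgAll i) = (S.toQ.all i : ℚ_[2]) ^ s :=
  PadicExp.exp_natCast_mul_plog_of_norm_lt (ℓ := 2) (S.norm_one_sub_ω_lt i) s

/-! ### The linear form -/

/-- `‖b_θ‖₂ ≤ 1`. [folklore] -/
theorem norm_bθ_le : ‖(S.bθ : ℚ_[2])‖ ≤ 1 := Padic.norm_int_le_one _

/-- `0 < ‖b_θ‖₂`. [folklore] -/
theorem norm_bθ_pos : 0 < ‖(S.bθ : ℚ_[2])‖ := norm_pos_iff.mpr (by exact_mod_cast S.bθ_ne)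

/-- **The linear form** `Λ = ∑ bⱼ log₂ αⱼ + b_θ log₂ θ ∈ ℚ₂`. [cite: Yu1990, Theorem 1] -/
def Λ : ℚ_[2] := ∑ j, (S.b j : ℚ_[2]) * S.lg j + (S.bθ : ℚ_[2]) * S.lgθ

/-- `Λ₀ = ∑ βⱼ lg j − lgθ` (`= −Λ/b_θ`). [cite: CijsouwWaldschmidt1977, Prop 1 (p. 183)] -/
def Λ₀ : ℚ_[2] := ∑ j : Fin S.d, (S.frame.β j : ℚ_[2]) * S.lg j - S.lgθ

/-- `Λ = −b_θ Λ₀`. [folklore] -/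
theorem Λ_eq : S.Λ = -(S.bθ : ℚ_[2]) * S.Λ₀ := by
  have hb : (S.bθ : ℚ_[2]) ≠ 0 := by exact_mod_cast S.bθ_ne
  unfold Λ Λ₀
  have e : ∀ j : Fin S.d, (S.frame.β j : ℚ_[2]) * S.lg j = -((S.b j : ℚ_[2]) * S.lg j) / S.bθ := by
    intro j; rw [show S.frame.β j = -(S.b j : ℚ) / S.bθ from rfl]; push_cast; field_simp
  simp_rw [e]
  rw [← Finset.sum_div, Finset.sum_neg_distrib]
  field_simp
  ring

/-- **`‖Λ‖ = ‖b_θ‖₂ · ‖Λ₀‖`.** [folklore] -/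
theorem norm_Λ_eq_mul : ‖S.Λ‖ = ‖(S.bθ : ℚ_[2])‖ * ‖S.Λ₀‖ := by
  rw [S.Λ_eq, norm_mul, norm_neg]

/-- The number `Θ = ∏ αⱼ^{bⱼ} θ^{b_θ} ∈ ℚ` whose `2`-adic distance to `1` is measured. [cite: Yu1990, Theorem 1] -/
def Θ : ℚ := (∏ j, S.α j ^ S.b j) * S.θ ^ S.bθ

/-- All `d + 1` exponents: `bⱼ` (`j < d`) and `b_θ` (last). [folklore] -/
def ball : Fin (S.d + 1) → ℤ := Fin.snoc S.b S.bθ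

/-- `Θ = ∏ᵢ ωᵢ^{ballᵢ}` in `ℚ₂`. [folklore] -/
theorem Θ_eq_prod_ω : (S.Θ : ℚ_[2]) = ∏ i : Fin (S.d + 1), S.ω i ^ S.ball i := by
  unfold Θ ω SetupQ.all ball
  rw [Fin.prod_univ_castSucc]
  simp only [Fin.snoc_castSucc, Fin.snoc_last]
  push_cast
  rfl

/-- **`Λ = log₂ Θ`** (`Θ = ∏ᵢ ωᵢ^{ballᵢ}`). [cite: Koblitz1984, Ch. IV §1] -/
theorem Λ_eq_plog : S.Λ = PadicExp.plog (∏ i : Fin (S.d + 1), S.ω i ^ S.ball i) := by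
  rw [PadicExp.plog_prod_zpow (ℓ := 2) univ _ _ fun i _ => S.norm_one_sub_ω_lt_one i]
  unfold Λ ball lg lgθ lgAll
  rw [Fin.sum_univ_castSucc]
  simp only [Fin.snoc_castSucc, Fin.snoc_last]

/-- `Θ` is a principal unit of the open ball: `‖1 − Θ‖₂ < 2⁻¹`. [cite: Koblitz1984, Ch. IV §1] -/
theorem norm_one_sub_Θ_lt : ‖1 - (S.Θ : ℚ_[2])‖ < ((2 : ℕ) : ℝ)⁻¹ := by
  rw [S.Θ_eq_prod_ω]
  exact PadicExp.norm_one_sub_prod_zpow_lt (ℓ := 2) univ _ _ fun i _ => S.norm_one_sub_ω_lt i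

/-- **`‖Λ‖ = ‖Θ − 1‖₂`.** [cite: Yu1990, §1.1] -/
theorem norm_Λ : ‖S.Λ‖ = ‖(S.Θ : ℚ_[2]) - 1‖ := by
  rw [S.Λ_eq_plog, ← S.Θ_eq_prod_ω, PadicExp.norm_plog_of_norm_lt (ℓ := 2) S.norm_one_sub_Θ_lt,
    norm_sub_rev]

/-! ### `2`-adic norms of the rational data -/

variable {h Lb : ℕ}

/-- **`‖βⱼ‖₂ ≤ 1`** (`ord₂ b_θ ≤ ord₂ bⱼ`). [cite: Yu1990, Theorem 2.1 (2.17)] -/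
theorem norm_β_le (j : Fin S.d) : ‖(S.frame.β j : ℚ_[2])‖ ≤ 1 := by
  rw [show S.frame.β j = -(S.b j : ℚ) / S.bθ from rfl]; push_cast
  rw [norm_div, norm_neg]
  by_cases hj : S.b j = 0
  · rw [hj]; simp
  refine div_le_one_of_le₀ ?_ (norm_nonneg _)
  have h1 : ‖((S.b j : ℚ) : ℚ_[2])‖ ≤ ‖((S.bθ : ℚ) : ℚ_[2])‖ := by
    rw [Padic.norm_eq_zpow_neg_valuation (by exact_mod_cast hj), Padic.valuation_ratCast,
      Padic.norm_eq_zpow_neg_valuation (by exact_mod_cast S.bθ_ne), Padic.valuation_ratCast,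
      padicValRat.of_int, padicValRat.of_int]
    exact zpow_le_zpow_right₀ (by norm_num) (neg_le_neg (Int.ofNat_le.mpr (S.hbmin j hj)))
  simpa using h1

/-- `‖γⱼ(u)‖₂ ≤ 1`. [folklore] -/
theorem norm_γ_le (u : Idx S.d h Lb) (j : Fin S.d) : ‖(S.frame.γ u j : ℚ_[2])‖ ≤ 1 := by
  unfold CW77.Setup.γ; push_cast
  refine (norm_add_le_max _ _).trans (max_le ?_ ?_)
  · exact_mod_cast Padic.norm_int_le_one (p := 2) (u.2.1 j : ℤ)
  · rw [norm_mul]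
    refine mul_le_one₀ ?_ (norm_nonneg _) (S.norm_β_le j)
    exact_mod_cast Padic.norm_int_le_one (p := 2) (u.2.2 : ℤ)

/-- `‖qA(u, τ')‖₂ ≤ 1`. [folklore] -/
theorem norm_qA_le (u : Idx S.d h Lb) (τ' : Fin S.d → ℕ) : ‖(S.frame.qA u τ' : ℚ_[2])‖ ≤ 1 := by
  unfold CW77.Setup.qA; push_cast
  rw [norm_prod]
  exact prod_le_one (fun j _ => norm_nonneg _) fun j _ => by
    rw [norm_pow]; exact pow_le_one₀ (norm_nonneg _) (S.norm_γ_le u j)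

/-- **`‖qE(u, s)‖₂ = 1`** (the generators are units). [folklore] -/
theorem norm_qE (u : Idx S.d h Lb) (s : ℕ) : ‖(S.toQ.qE u s : ℚ_[2])‖ = 1 := by
  rw [S.toQ.qE_eq_prod_all]; push_cast
  rw [norm_prod]
  exact prod_eq_one fun i _ => by rw [norm_pow, S.norm_all, one_pow]

end TwoSetup

end Summit.ABC.StewartYu

end
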